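import Summits.QuantumFields.BalabanUV.Beta.FP.TorusCompositeObjects

/-!
# `BalabanUV.Beta.FP.TorusCompositeUnimodular` — road «FP» for binder row D1, ROUTE T, SPEC-27 (SLICE-m) part 1: **THE ONE-SHOT FADDEEV–POPOV FACTOR OF
# THE COMPOSITE LITERAL IS UNIMODULAR AT EVERY DEPTH** — the tower twin of `TorusCombNestedBasis.W0_eq ∕ abs_det_bigCombRows_mul_fromCols_eq_one`
# (`hPW^{(n)}` of the OWNER's composite torus call)

WHAT.  With the objects of `FP/TorusCompositeObjects` (leaf-06 g20): the one-shot comb slice `bigP Lc M rs hrs n` (big comb of ratio `bigRatio Lc n = Lc^{n+1}`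
on the finest torus `towerTorus Lc M n`, rows sorted `NParam` by `towerEquiv`) and the tower generator matrix `towerGen Lc M rs n` (the gauge modes of all
`n+1` levels as fields of the finest torus).  §1 a congruence kit along an equality of tori (`idxCongr`, `tgrad_congr`); §2 `towerGenIdx` (full torus-index rows;
`towerGen` is its field-slot reading); §3 the UNIPOTENT tower evaluation matrix `towerEvalC` (by recursion over `TorusCombNestedBasis.evalC`, `det = 1`) and
**THE TOWER `W₀`-LEMMA `towerGenIdx_eq`**: `towerGenIdx = (tgrad (finest)↾Res_big, columns re-indexed by towerEquiv) · towerEvalC` — induction, the step IS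
`W0_eq` at the single-shot presentation `fine (bigRatio Lc n) M` of the finest torus, transported by the site-preserving `resCongr ∕ pboxCongr ∕ idxCongr`;
§4 **`abs_det_bigP_mul_towerGen_eq_one : |det (bigP … n * towerGen … n)| = 1`** for every depth `n` (`Lc ∣ M i`) — `TorusCombRows.abs_det_combRowsT_mul_tgrad_eq_one`
at the big blocking + the tower `W₀`-lemma + `det towerEvalC = 1` — and its `det ≠ 0` form = the binder `hPW` of the OWNER's composite call (#12's `hcP ∕ hPW`
= the case `n = 1`).  [folklore] determinant bookkeeping over OUR torus objects; nothing of the dictionary ∕ Bałaban's asserted.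

HONEST DEPENDENCY (page 1, mandatory): continuum YM on T⁴ ⇐ BetaPertH ∧ nine spine estimates (0/9 proved); BetaPertH ⇐ (D1) ∧ (D4) ∧ CAP+tail;
G-an2-4 gates asym, D1 and NE2/3/4.  HONEST FRAMING (cell contract, verbatim): «discharging `BetaPertH` makes Bałaban's UV stability UNCONDITIONAL —
a real constructive-QFT result; it is NOT the continuum limit and NOT the Clay problem.»  ABSOLUTE RULE (cell charter, verbatim): «No internally-minted
statement may enter as a cited fact. Every hypothesis is either kernel-proved in this package or a verbatim quotation of a PUBLISHED theorem with page
reference. The manuscript(s) under audit are NOT citable for their own disputed steps — they are the thing under adjudication; programme-internal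
(2001/route/tribunal) claims are never citable.»  [our object] bookkeeping + [folklore] linear algebra; no `def … : Prop`, nothing cited, 0 sorry;
0 estimates; 0∕4 row-D1 binders; NOT (T-ID), NOT SDF, NOT D1, NOT BetaPertH, NOT continuum, NOT Clay.  D1 formalisation swarm LEAF PROVER 06
(b2b-balaban-beta-d1-formalise-leaf-06 gen 20), 2026-08-22.  No existing file touched.
-/

noncomputable section

namespace Summit.QuantumFields.BalabanUV.Beta.FP.TorusCompositeUnimodular

open Matrix
open Literature.MathematicalPhysics.QuantumFieldTheory.Balaban1983to89
open Literature.MathematicalPhysics.QuantumFieldTheory.Balaban1983to89.Beta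
open B5Prop11Plancherel (fine)
open B6Lemma24Torus (pbox)
open AffineAveraging (Site toSite)
open OneStepResolventKernel (Fib)
open Summit.QuantumFields.BalabanUV.Beta.FP.KernelPeriodisationFib (Idx)
open Summit.QuantumFields.BalabanUV.Beta.FP.TorusGaugeCovariance (tgrad)
open Summit.QuantumFields.BalabanUV.Beta.FP.TorusGaugeCovarianceCoarse (tgradBlock)
open Summit.QuantumFields.BalabanUV.Beta.FP.TorusCombRows (Res combRowsT abs_det_combRowsT_mul_tgrad_eq_one)
open Summit.QuantumFields.BalabanUV.Beta.FP.TorusCombNestedBasis (resBigEquiv evalC det_evalC W0_eq submatrix_mul_submatrix combRowsT_fieldSlot_mul)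
open Summit.QuantumFields.BalabanUV.Beta.FP.TorusCompositeObjects

variable {d : ℕ}

/-! ## §1 Congruence along an equality of tori, at the torus-index level -/

section Congr

/-- [our object — bookkeeping] `Idx A (Fib d) ≃ Idx A′ (Fib d)` along `A = A′`, site and slot preserved by `rfl`. -/
def idxCongr {A A' : Fin (d + 1) → ℕ} (h : A = A') : Idx A (Fib d) ≃ Idx A' (Fib d) :=
  Equiv.prodCongr (pboxCongr h) (Equiv.refl _)

/-- [folklore] **THE TORUS GRADIENT IS NATURAL ALONG AN EQUALITY OF TORI**: `tgrad A = (tgrad A′)` re-indexed by the congruences. -/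
theorem tgrad_congr {A A' : Fin (d + 1) → ℕ} (h : A = A') : tgrad A = (tgrad A').submatrix (idxCongr h) (pboxCongr h) := by
  cases h; rfl

/-- [folklore] the «pull-outside» twin of `TorusCompositeObjects.towerTorus_succ_eq_fine` (the OWNER d1-p3's BOTTOM-ROWS transport recipe):
`towerTorus Lc M (n+1) = fine Lc (towerTorus Lc M n)` — PROPOSITIONAL only (the recursion pushes `fine Lc` inside). -/
theorem towerTorus_succ_eq_fine_towerTorus (Lc : ℕ) (M : Fin (d + 1) → ℕ) (n : ℕ) :
    towerTorus Lc M (n + 1) = fine Lc (towerTorus Lc M n) := by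
  funext μ
  simp only [towerTorus_apply, fine, pow_succ]
  ring

end Congr

/-! ## §2 The tower generator matrix on the full torus indices -/

section GenIdx

variable (Lc : ℕ) [NeZero Lc]

/-- [our object — bookkeeping] **`W₀^{(n)}` ON THE FULL TORUS INDICES** (same recursion as `towerGen`, rows = `Idx (finest) (Fib d)`; `towerGen` is its
reading on the field slots, `towerGen_eq_submatrix`). -/
def towerGenIdx : (M : Fin (d + 1) → ℕ) → [∀ μ, NeZero (M μ)] → (rs : ℕ → (Fin (d + 1) → ℕ)) → (n : ℕ) →
    Matrix (Idx (towerTorus Lc M n) (Fib d)) (NParam Lc M rs n) ℝ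
  | M, _, rs, 0 => (tgrad M).submatrix id (Subtype.val : Res (toSite (rs 0)) Lc M → ↥(pbox M))
  | M, _, rs, n + 1 => Matrix.fromCols
      ((tgradBlock M (bigRatio Lc n)).submatrix (idxCongr (towerTorus_fine_eq_fine Lc M n))
        (Subtype.val : Res (toSite (rs 0)) Lc M → ↥(pbox M)))
      (towerGenIdx (fine Lc M) (fun k => rs (k + 1)) n)

/-- [folklore] `towerGen` is `towerGenIdx` read on the field slots. -/
theorem towerGen_eq_submatrix :
    ∀ (n : ℕ) (M : Fin (d + 1) → ℕ) [∀ μ, NeZero (M μ)] (rs : ℕ → (Fin (d + 1) → ℕ)),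
      towerGen Lc M rs n = (towerGenIdx Lc M rs n).submatrix
        (fun b : ↥(pbox (towerTorus Lc M n)) × Fin (d + 1) => ((b.1, Sum.inl b.2) : Idx (towerTorus Lc M n) (Fib d))) id
  | 0, M, _, rs => rfl
  | n + 1, M, _, rs => by
    rw [towerGen_succ, towerGen_eq_submatrix n (fine Lc M) (fun k => rs (k + 1))]
    ext b c
    rcases c with c | c <;> rfl

end GenIdx

/-! ## §3 The unipotent tower evaluation matrix and the tower `W₀`-lemma -/

section EvalC

variable (Lc : ℕ) [NeZero Lc]

/-- [our object — bookkeeping] the depth-`(n+1)` SORTING IN THE SINGLE-SHOT COORDINATES `Res_top ⊕ Res_low(fine (bigRatio Lc n) M)` — the inner part of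
`towerEquiv … (n+1)` after `resBigEquiv`: the top summand kept, the lower big residuals moved to the iterate torus (`resCongr`) and sorted one level down. -/
def lowerSort (M : Fin (d + 1) → ℕ) (rs : ℕ → (Fin (d + 1) → ℕ)) (hrs : ∀ k i, 0 ≤ toSite (rs k) i ∧ toSite (rs k) i < (Lc : ℤ)) (n : ℕ) :
    Res (toSite (rs 0)) Lc M ⊕ Res (bigRoot Lc (fun k => rs (k + 1)) n) (bigRatio Lc n) (fine (bigRatio Lc n) M) ≃ NParam Lc M rs (n + 1) :=
  Equiv.sumCongr (Equiv.refl _)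
    ((resCongr (towerTorus_fine_eq_fine Lc M n).symm).trans (towerEquiv Lc (fine Lc M) (fun k => rs (k + 1)) (fun k => hrs (k + 1)) n))

/-- [folklore] `towerEquiv … (n+1)` factors as `resCongr`, then `resBigEquiv`, then `lowerSort` (by `rfl`). -/
theorem towerEquiv_succ (M : Fin (d + 1) → ℕ) (rs : ℕ → (Fin (d + 1) → ℕ)) (hrs : ∀ k i, 0 ≤ toSite (rs k) i ∧ toSite (rs k) i < (Lc : ℤ)) (n : ℕ) :
    towerEquiv Lc M rs hrs (n + 1)
      = ((resCongr (towerTorus_succ_eq_fine Lc M n)).trans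
          ((resBigEquiv (bigRatio Lc n) Lc (bigRoot Lc (fun k => rs (k + 1)) n) (toSite (rs 0)) M
              (bigRatio_pos Lc (Nat.pos_of_ne_zero (NeZero.ne Lc)) n)
              (bigRoot_range Lc (Nat.pos_of_ne_zero (NeZero.ne Lc)) n (fun k => rs (k + 1)) (fun k => hrs (k + 1)))
              (Nat.pos_of_ne_zero (NeZero.ne Lc)) (hrs 0)).trans
            (lowerSort Lc M rs hrs n))) := rfl

/-- [our object — bookkeeping] **THE TOWER EVALUATION MATRIX** («evaluate the nested modes at the big-block non-root sites», level by level): `1` at depth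
`0`; at depth `n+1`, IN THE SINGLE-SHOT COORDINATES, the depth-2 `evalC (bigRatio Lc n) Lc (bigRoot lower) (toSite (rs 0)) M` times
`fromBlocks 1 0 0 (towerEvalC lower, pulled back)`, the whole re-indexed `NParam` by `lowerSort`. -/
def towerEvalC : (M : Fin (d + 1) → ℕ) → (rs : ℕ → (Fin (d + 1) → ℕ)) → (hrs : ∀ k i, 0 ≤ toSite (rs k) i ∧ toSite (rs k) i < (Lc : ℤ)) →
    (n : ℕ) → Matrix (NParam Lc M rs n) (NParam Lc M rs n) ℝ
  | _, _, _, 0 => 1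
  | M, rs, hrs, n + 1 =>
    (evalC (bigRatio Lc n) Lc (bigRoot Lc (fun k => rs (k + 1)) n) (toSite (rs 0)) M
        * (Matrix.fromBlocks 1 0 0
            ((towerEvalC (fine Lc M) (fun k => rs (k + 1)) (fun k => hrs (k + 1)) n).submatrix
              ((resCongr (towerTorus_fine_eq_fine Lc M n).symm).trans
                (towerEquiv Lc (fine Lc M) (fun k => rs (k + 1)) (fun k => hrs (k + 1)) n))
              ((resCongr (towerTorus_fine_eq_fine Lc M n).symm).trans
                (towerEquiv Lc (fine Lc M) (fun k => rs (k + 1)) (fun k => hrs (k + 1)) n)))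
            : Matrix (Res (toSite (rs 0)) Lc M ⊕ Res (bigRoot Lc (fun k => rs (k + 1)) n) (bigRatio Lc n) (fine (bigRatio Lc n) M))
                (Res (toSite (rs 0)) Lc M ⊕ Res (bigRoot Lc (fun k => rs (k + 1)) n) (bigRatio Lc n) (fine (bigRatio Lc n) M)) ℝ)).submatrix
      (lowerSort Lc M rs hrs n).symm (lowerSort Lc M rs hrs n).symm

/-- [folklore] **`det towerEvalC = 1`** (unipotent at every level). -/
theorem det_towerEvalC :
    ∀ (n : ℕ) (M : Fin (d + 1) → ℕ) (rs : ℕ → (Fin (d + 1) → ℕ)) (hrs : ∀ k i, 0 ≤ toSite (rs k) i ∧ toSite (rs k) i < (Lc : ℤ)),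
      (towerEvalC Lc M rs hrs n).det = 1
  | 0, M, rs, hrs => Matrix.det_one
  | n + 1, M, rs, hrs => by
    rw [towerEvalC, Matrix.det_submatrix_equiv_self, Matrix.det_mul, det_evalC, Matrix.det_fromBlocks_zero₁₂, Matrix.det_one,
      Matrix.det_submatrix_equiv_self, det_towerEvalC n (fine Lc M) (fun k => rs (k + 1)) (fun k => hrs (k + 1)), mul_one, mul_one]

/-- [folklore] `fromCols A (B * C) = fromCols A B * fromBlocks 1 0 0 C`. -/
theorem fromCols_mul_right {m o₁ o₂ : Type*} [Fintype o₁] [Fintype o₂] [DecidableEq o₁] (A : Matrix m o₁ ℝ) (B : Matrix m o₂ ℝ) (C : Matrix o₂ o₂ ℝ) :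
    Matrix.fromCols A (B * C) = (Matrix.fromCols A B : Matrix m (o₁ ⊕ o₂) ℝ) * (Matrix.fromBlocks 1 0 0 C : Matrix (o₁ ⊕ o₂) (o₁ ⊕ o₂) ℝ) := by
  ext i j
  rcases j with j | j
  · simp only [Matrix.fromCols_apply_inl, Matrix.mul_apply, Fintype.sum_sum_type, Matrix.fromBlocks_apply₁₁, Matrix.fromBlocks_apply₂₁,
      Matrix.fromCols_apply_inr, Matrix.zero_apply, mul_zero, Finset.sum_const_zero, add_zero, Matrix.one_apply, mul_ite, mul_one,
      Finset.sum_ite_eq', Finset.mem_univ, if_true]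
  · simp only [Matrix.fromCols_apply_inr, Matrix.mul_apply, Fintype.sum_sum_type, Matrix.fromBlocks_apply₁₂, Matrix.fromBlocks_apply₂₂,
      Matrix.fromCols_apply_inl, Matrix.zero_apply, mul_zero, Finset.sum_const_zero, zero_add]

/-- [folklore] `fromCols` commutes with a common row re-indexing (definitional). -/
theorem fromCols_submatrix_rows {l m o₁ o₂ : Type*} (A : Matrix m o₁ ℝ) (B : Matrix m o₂ ℝ) (r : l → m) :
    Matrix.fromCols (A.submatrix r id) (B.submatrix r id) = (Matrix.fromCols A B).submatrix r id := by
  ext i j; rcases j with j | j <;> rfl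

/-- [folklore] `fromCols` with the second block's columns re-indexed by an equivalence = the whole re-indexed by `sumCongr refl`. -/
theorem fromCols_submatrix_right {m o₁ o₂ o₃ : Type*} (A : Matrix m o₁ ℝ) (B : Matrix m o₂ ℝ) (e : o₃ ≃ o₂) :
    Matrix.fromCols A (B.submatrix id e) = (Matrix.fromCols A B).submatrix id (Equiv.sumCongr (Equiv.refl o₁) e) := by
  ext i j; rcases j with j | j <;> rfl

/-- **THE TOWER `W₀`-LEMMA**: the tower generator matrix is the BIG-comb presentation of the finest torus's gauge modes at the big residual parameters,
columns sorted by `towerEquiv`, times the unipotent `towerEvalC` — by induction, the step being `TorusCombNestedBasis.W0_eq` at the single-shot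
presentation `fine (bigRatio Lc n) M` of the finest torus, transported along `towerTorus_succ_eq_fine` by the site-preserving congruences. -/
theorem towerGenIdx_eq :
    ∀ (n : ℕ) (M : Fin (d + 1) → ℕ) [∀ μ, NeZero (M μ)] (rs : ℕ → (Fin (d + 1) → ℕ))
      (hrs : ∀ k i, 0 ≤ toSite (rs k) i ∧ toSite (rs k) i < (Lc : ℤ)),
      towerGenIdx Lc M rs n
        = ((tgrad (towerTorus Lc M n)).submatrix id
              (Subtype.val : Res (bigRoot Lc rs n) (bigRatio Lc n) (towerTorus Lc M n) → ↥(pbox (towerTorus Lc M n)))).submatrix id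
            (towerEquiv Lc M rs hrs n).symm
          * towerEvalC Lc M rs hrs n
  | 0, M, _, rs, hrs => by
    rw [towerEvalC, Matrix.mul_one, towerEquiv_zero]; rfl
  | n + 1, M, _, rs, hrs => by
    dsimp only [towerTorus_succ]
    have hLc : 0 < Lc := Nat.pos_of_ne_zero (NeZero.ne Lc)
    haveI : NeZero (bigRatio Lc n) := ⟨(bigRatio_pos Lc hLc n).ne'⟩
    have hT : towerTorus Lc (fine Lc M) n = fine (bigRatio Lc n) M := towerTorus_fine_eq_fine Lc M n
    -- the induction hypothesis one level down and `W0_eq` at the single-shot presentation of the finest torus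
    have ih := towerGenIdx_eq n (fine Lc M) (fun k => rs (k + 1)) (fun k => hrs (k + 1))
    have w0 := W0_eq (M' := M) (N := bigRatio Lc n) (N₂ := Lc) (ρ := bigRoot Lc (fun k => rs (k + 1)) n) (ρ₂ := toSite (rs 0))
      (bigRatio_pos Lc hLc n) (bigRoot_range Lc hLc n (fun k => rs (k + 1)) (fun k => hrs (k + 1))) hLc (hrs 0)
    rw [towerGenIdx, ih, towerEvalC, towerEquiv_succ]
    -- names (AFTER the unfoldings, so that they abstract the goal): lower sorting, its single-shot twin, the depth-2 sorting, the lower `C`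
    set eL := towerEquiv Lc (fine Lc M) (fun k => rs (k + 1)) (fun k => hrs (k + 1)) n with heL
    set e' : Res (bigRoot Lc (fun k => rs (k + 1)) n) (bigRatio Lc n) (fine (bigRatio Lc n) M) ≃ NParam Lc (fine Lc M) (fun k => rs (k + 1)) n :=
      (resCongr hT.symm).trans eL with he'
    set rbe := resBigEquiv (bigRatio Lc n) Lc (bigRoot Lc (fun k => rs (k + 1)) n) (toSite (rs 0)) M
        (bigRatio_pos Lc hLc n) (bigRoot_range Lc hLc n (fun k => rs (k + 1)) (fun k => hrs (k + 1))) hLc (hrs 0) with hrbe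
    set CL := towerEvalC Lc (fine Lc M) (fun k => rs (k + 1)) (fun k => hrs (k + 1)) n with hCL
    set LS := lowerSort Lc M rs hrs n with hLS
    -- the single-shot objects of `w0`
    set r : Idx (towerTorus Lc (fine Lc M) n) (Fib d) → Idx (fine (bigRatio Lc n) M) (Fib d) := ⇑(idxCongr hT) with hr
    set A₀ := (tgrad (fine (bigRatio Lc n) M)).submatrix id
        (fun s : Res ((bigRatio Lc n : ℤ) • toSite (rs 0) + bigRoot Lc (fun k => rs (k + 1)) n) (bigRatio Lc n * Lc)
          (fine (bigRatio Lc n) M) => s.1) with hA₀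
    set B₁ := (tgradBlock M (bigRatio Lc n)).submatrix id (fun t : Res (toSite (rs 0)) Lc M => t.1) with hB₁
    set B₂ := (tgrad (fine (bigRatio Lc n) M)).submatrix id
        (fun s : Res (bigRoot Lc (fun k => rs (k + 1)) n) (bigRatio Lc n) (fine (bigRatio Lc n) M) => s.1) with hB₂
    set F : Matrix (Res (toSite (rs 0)) Lc M ⊕ Res (bigRoot Lc (fun k => rs (k + 1)) n) (bigRatio Lc n) (fine (bigRatio Lc n) M))
        (Res (toSite (rs 0)) Lc M ⊕ Res (bigRoot Lc (fun k => rs (k + 1)) n) (bigRatio Lc n) (fine (bigRatio Lc n) M)) ℝ :=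
      Matrix.fromBlocks 1 0 0 (CL.submatrix e' e') with hF
    set Y := evalC (bigRatio Lc n) Lc (bigRoot Lc (fun k => rs (k + 1)) n) (toSite (rs 0)) M * F with hY
    -- `w0` with its rows pulled back to the iterate torus
    have w0' : (Matrix.fromCols B₁ B₂).submatrix r id = A₀.submatrix r rbe.symm * evalC (bigRatio Lc n) Lc (bigRoot Lc (fun k => rs (k + 1)) n) (toSite (rs 0)) M := by
      rw [w0, Matrix.submatrix_mul _ _ r id id Function.bijective_id, Matrix.submatrix_submatrix, Matrix.submatrix_id_id]
      rfl
    -- the common form of both sides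
    have hassoc : (Matrix.fromCols B₁ B₂).submatrix r id * F = A₀.submatrix r rbe.symm * Y := by
      rw [w0', hY]; exact Matrix.mul_assoc _ _ _
    have key : (Matrix.fromCols (B₁.submatrix r id) (B₂.submatrix r id) * F).submatrix id LS.symm
        = (A₀.submatrix r rbe.symm).submatrix id LS.symm * Y.submatrix LS.symm LS.symm := by
      rw [Matrix.submatrix_mul_equiv, fromCols_submatrix_rows, hassoc]
    convert key using 1
    · -- LHS: `fromCols D_top (G_low↾eL.symm · C_L)` entrywise
      ext q c
      have hLS' : ∀ c', LS.symm c' = (Equiv.sumCongr (Equiv.refl _) e').symm c' := fun _ => rfl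
      rcases c with t | y
      · rw [Matrix.submatrix_apply, hLS', Equiv.sumCongr_symm, Equiv.sumCongr_apply, Equiv.refl_symm, Sum.map_inl, Equiv.coe_refl, id_eq, id_eq,
          Matrix.fromCols_apply_inl]
        erw [Matrix.mul_apply, Fintype.sum_sum_type]
        simp only [Matrix.fromCols_apply_inl, Matrix.fromCols_apply_inr, hF, Matrix.fromBlocks_apply₁₁, Matrix.fromBlocks_apply₂₁,
          Matrix.zero_apply, mul_zero, Finset.sum_const_zero, add_zero, Matrix.one_apply, mul_ite, mul_one, Finset.sum_ite_eq',
          Finset.mem_univ, if_true]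
        rfl
      · rw [Matrix.submatrix_apply, hLS', Equiv.sumCongr_symm, Equiv.sumCongr_apply, Equiv.refl_symm, Sum.map_inr, id_eq,
          Matrix.fromCols_apply_inr]
        erw [Matrix.mul_apply, Matrix.mul_apply, Fintype.sum_sum_type]
        simp only [Matrix.fromCols_apply_inl, Matrix.fromCols_apply_inr, hF, Matrix.fromBlocks_apply₁₂, Matrix.fromBlocks_apply₂₂,
          Matrix.zero_apply, mul_zero, Finset.sum_const_zero, zero_add, Matrix.submatrix_apply, id_eq, Equiv.apply_symm_apply]
        rw [← Equiv.sum_comp e']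
        refine Finset.sum_congr rfl fun x _ => ?_
        rw [he', Equiv.trans_apply, Equiv.symm_apply_apply, tgrad_congr hT]
        rfl
    · -- RHS: the big sorting's first factor read through `A₀`
      congr 1
      rw [tgrad_congr hT]
      ext q c
      rfl

end EvalC

/-! ## §4 `hPW^{(n)}`: the one-shot Faddeev–Popov factor of the composite literal is unimodular at every depth -/

section Unimodular

variable (Lc : ℕ) [NeZero Lc]

omit [NeZero Lc] in
/-- [folklore] the big ratio divides the finest torus's moduli when `Lc ∣ M i`. -/
theorem bigRatio_dvd_towerTorus {M : Fin (d + 1) → ℕ} (hM : ∀ i, Lc ∣ M i) (n : ℕ) (i : Fin (d + 1)) :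
    bigRatio Lc n ∣ towerTorus Lc M n i := by
  obtain ⟨c, hc⟩ := hM i
  exact ⟨c, by rw [towerTorus_apply, bigRatio_eq_pow, hc]; ring⟩

/-- **`P^{(n+1)} · W₀^{(n)}` IN THE BIG-COMB BASIS**: the one-shot slice against the tower generators is the big comb's own unimodular pairing
`combRowsT · tgrad↾Res_big`, re-indexed by `towerEquiv` on both sides, times the unipotent `towerEvalC` (the shape every one-shot-side letter of the
composite call is discharged in: `hPW` below; `uP'` in the next file). -/
theorem bigP_mul_towerGen_eq (M : Fin (d + 1) → ℕ) [∀ μ, NeZero (M μ)] (rs : ℕ → (Fin (d + 1) → ℕ))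
    (hrs : ∀ k i, 0 ≤ toSite (rs k) i ∧ toSite (rs k) i < (Lc : ℤ)) (hM : ∀ i, Lc ∣ M i) (n : ℕ) :
    bigP Lc M rs hrs n * towerGen Lc M rs n
      = (combRowsT (bigRoot Lc rs n) (bigRatio Lc n) (towerTorus Lc M n)
            * (tgrad (towerTorus Lc M n)).submatrix id
                (Subtype.val : Res (bigRoot Lc rs n) (bigRatio Lc n) (towerTorus Lc M n) → ↥(pbox (towerTorus Lc M n)))).submatrix
          (towerEquiv Lc M rs hrs n).symm (towerEquiv Lc M rs hrs n).symm
        * towerEvalC Lc M rs hrs n := by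
  have hLc : 0 < Lc := Nat.pos_of_ne_zero (NeZero.ne Lc)
  rw [bigP, towerGen_eq_submatrix,
    combRowsT_fieldSlot_mul (bigRatio_pos Lc hLc n) (bigRoot_range Lc hLc n rs hrs) (bigRatio_dvd_towerTorus Lc hM n),
    towerGenIdx_eq Lc n M rs hrs, ← Matrix.mul_assoc]
  erw [submatrix_mul_submatrix]
  rfl

/-- **`|det (P^{(n+1)} · W₀^{(n)})| = 1` AT EVERY DEPTH** — the one-shot comb slice of the `(n+1)`-level literal against the tower generator matrix is
UNIMODULAR: `TorusCombRows.abs_det_combRowsT_mul_tgrad_eq_one` at the big blocking on the finest torus, the tower `W₀`-lemma `towerGenIdx_eq`, and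
`det towerEvalC = 1`.  At `n = 1` this is #12's `hcP` (`NestedStepLawTorusInstance.torus_uniP`) by `bigP_one ∕ towerGen_one`. -/
theorem abs_det_bigP_mul_towerGen_eq_one (M : Fin (d + 1) → ℕ) [∀ μ, NeZero (M μ)] (rs : ℕ → (Fin (d + 1) → ℕ))
    (hrs : ∀ k i, 0 ≤ toSite (rs k) i ∧ toSite (rs k) i < (Lc : ℤ)) (hM : ∀ i, Lc ∣ M i) (n : ℕ) :
    |(bigP Lc M rs hrs n * towerGen Lc M rs n).det| = 1 := by
  have hLc : 0 < Lc := Nat.pos_of_ne_zero (NeZero.ne Lc)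
  rw [bigP_mul_towerGen_eq Lc M rs hrs hM n, Matrix.det_mul, det_towerEvalC, mul_one]
  erw [Matrix.det_submatrix_equiv_self]
  exact abs_det_combRowsT_mul_tgrad_eq_one (bigRatio_pos Lc hLc n) (bigRoot_range Lc hLc n rs hrs) (bigRatio_dvd_towerTorus Lc hM n)

/-- **`hPW^{(n)}` AS THE OWNER's COMPOSITE CALL DISPLAYS IT**: `det (P^{(n+1)} · W₀^{(n)}) ≠ 0`. -/
theorem det_bigP_mul_towerGen_ne_zero (M : Fin (d + 1) → ℕ) [∀ μ, NeZero (M μ)] (rs : ℕ → (Fin (d + 1) → ℕ))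
    (hrs : ∀ k i, 0 ≤ toSite (rs k) i ∧ toSite (rs k) i < (Lc : ℤ)) (hM : ∀ i, Lc ∣ M i) (n : ℕ) :
    (bigP Lc M rs hrs n * towerGen Lc M rs n).det ≠ 0 := by
  intro h
  have h1 := abs_det_bigP_mul_towerGen_eq_one Lc M rs hrs hM n
  rw [h, abs_zero] at h1
  exact zero_ne_one h1

end Unimodular


end Summit.QuantumFields.BalabanUV.Beta.FP.TorusCompositeUnimodular

end
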